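import Literature.Probability.RandomPlanarGeometry.HexSAWSurfaceWallRateStrictMono
import Literature.Probability.RandomPlanarGeometry.HexSAWSurfaceWallPotential
import HarnessLib

/-!
# The local exponent of the adsorbed wall growth rate is PINCHED: for `μ⁴ < y ≤ y'`,
# `(y'/y)^{1/m(y)} ≤ β(y')²/β(y)² ≤ (y'/y)^{(1 + 1/m(y'))/2} ≤ (y'/y)^{1 − 1/(10 y'² + 4)}`

Topic `Literature/Probability/RandomPlanarGeometry` (lane «pcv-sawmu», a-idea-1 g30, car 54 «EXPONENT-PINCH»; parents:
`HexSAWSurfaceWallRateStrictMono.lean` (car 53: the LOWER chord `log(y'/y) ≤ m(y)·log(β(y')²/β(y)²)` from Kesten's relation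
at two fugacities and Jensen's inequality for the first-renewal law, `div_rpow_inv_pwbMean_le`, `log_sq_wallRate_div_two_sided`)
→ `HexSAWSurfaceWallRenewal.lean` (positive wall bridges `pwb n`, irreducible ones `ipwb n`, `Λ_n(y) = IPWB n y`, the renewal law
`f_s(y) = pwbLaw y s = Λ_{2s}(y) β(y)^{−2s}`, its mean `m(y) = pwbMean y`, the ADSORBED KESTEN RELATION `hasSum_pwbLaw : Σ_s f_s(y) = 1`
and `summable_mul_pwbLaw` for `y > μ⁴ = 6 + 4√2`, and the ENTROPY LEMMA `four_mul_visits_le : ω ∈ ipwb n → 4·visits ≤ n + 2`);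
`HexSAWSurfaceWallRateSqrtMonotone.lean` (`wallRate_mono`, `wallRate_le_sqrt_mul : β(y') ≤ √(y'/y)·β(y)`);
`HexSAWSurfaceWallPotential.lean` (`add_inv_le_wallRate_sq : y + 1/(5y) ≤ β(y)²` for `y ≥ 2`)).

THE STATEMENT.  `β(y) = wallRate y` is the growth rate of honeycomb wall bridges with surface fugacity `y` (brick-wall frame; `β(y)²` per two
steps).  It is non-decreasing and `log β` is a convex function of `log y` [BeatonBousquetMelouDeGierDuminilCopinGuttmann2014, §3.1,
Proposition 5], so the local exponent `ρ(y) := d log β(y)² / d log y` exists off a countable set and is the DENSITY OF SURFACE VISITS per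
two steps of a long adsorbed bridge [HammersleyTorrieWhittington1982, §2; JansevanRensburg2000, §3.3, (3.17)].  The tree knows the chords
`0 ≤ log(β(y')²/β(y)²) ≤ log(y'/y)` (`wallRate_mono`, `wallRate_le_sqrt_mul`: every step pair carries at most one visit) and, in the
adsorbed renewal regime `y > μ⁴`, car 53's lower chord `log(y'/y)/m(y) ≤ log(β(y')²/β(y)²)` (a visit density at least the RENEWAL
DENSITY `1/m(y)`).  THIS FILE proves the complementary UPPER chord strictly inside the trivial one:

  `log(β(y')²/β(y)²) ≤ ½ (1 + 1/m(y')) · log(y'/y)`   for all `μ⁴ < y ≤ y'`   (`log_sq_wallRate_div_le_half_mul_log`),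

so that the exponent is PINCHED between the renewal density and the average of the renewal density with the maximal per-piece visit
density `½`:  `1/m(y) ≤ ρ ≤ ½ + 1/(2 m(y'))` (`log_sq_wallRate_div_pinch`, power form `sq_wallRate_div_pinch`).  With the explicit floor
`m(y) ≥ 1 + 1/(5y² + 1)` (`one_add_inv_le_pwbMean`, from `f₁(y) ≤ y/β(y)²` and the tree's window `β² ≥ y + 1/(5y)`) this gives the
EXPLICIT DEFECT DENSITY of the strongly adsorbed phase:

  `log(β(y')²/β(y)²) ≤ (1 − 1/(10 y'² + 4)) · log(y'/y)`   for all `μ⁴ < y ≤ y'`   (`log_sq_wallRate_div_le_explicit`),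

i.e. a long adsorbed bridge at fugacity `y` spends at least a fraction `1/(10y² + 4)` of its (even) times OFF the wall — the correct order
`y⁻²` (the expansion `β² = y + 1/y + 1/y² + 2/y³ + O(y⁻⁴)` of the tree's windows gives `1 − ρ(y) = 2/y² + O(y⁻³)` formally).  A by-product
is a GAP-FREE one-sided comparison for the mean renewal length, which is not known to be monotone: `1/m(y) ≤ ½(1 + 1/m(y'))` for
`y ≤ y'` (`inv_pwbMean_le_half_add`), hence `m(y') − 1 ≤ 2(m(y) − 1)/(2 − m(y))` whenever `m(y) < 2` (`pwbMean_sub_one_le_of_lt_two`):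
going UP in fugacity, however far, the excess mean block length can at most double (to first order).

THE MECHANISM (entropy lemma at two fugacities + Kesten at the LOWER fugacity + Jensen under the law at the UPPER one).  By the
entropy lemma an irreducible piece of length `2k` has `v ≤ (k+1)/2` visits, so for `y ≤ y'`:  `y^v = y'^v (y/y')^v ≥ y'^v √(y/y')^{k+1}`,
i.e. `Λ_{2k}(y) ≥ √(y/y')^{k+1} Λ_{2k}(y')` (`sqrt_pow_mul_IPWB_le`).  Divide by `β(y)^{2k}` and sum: Kesten's relation AT `y` gives
`1 = Σ_k f_k(y) ≥ √(y/y') · Σ_k f_k(y') r^k` with `r := √(y/y')·β(y')²/β(y)²` (`sqrt_mul_tsum_pwbLaw_mul_pow_le_one`; the series is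
dominated by `Σ f_k(y)`, `summable_pwbLaw_mul_pow_pinch`).  Jensen for the convex `k ↦ r^k` under the probability law `f(y')` (mass `1` by
Kesten AT `y'`, mean `m(y')`) gives `Σ_k f_k(y') r^k ≥ r^{m(y')}` for EVERY `r > 0` once the series converges
(`rpow_pwbMean_le_tsum_mul_pow_of_summable` — car 53 proved the case `r ≤ 1`; here `r` may exceed `1`).  Hence `r^{m(y')} ≤ √(y'/y)`
(`rpow_pwbMean_pinch_le`), which is the upper chord after taking logarithms.  (Jensen under the law at the LOWER fugacity `y`, as in car 53,
only returns the trivial exponent `1`: the base measure must sit at the upper end.)  The explicit floor on `m`: `m − 1 = Σ (k−1) f_k ≥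
Σ_{k ≥ 2} f_k = 1 − f₁` and `f₁(y) = Λ₂(y)/β² ≤ y/β²` because the only positive wall bridge of length `2` is the straight one
(private `pwb_two_subset_ep`), and `y/β² ≤ y/(y + 1/(5y)) = 5y²/(5y² + 1)`.

MAIN RESULTS (`μ⁴ < y ≤ y'`, `β = wallRate`, `m = pwbMean`, `L := log(y'/y) ≥ 0`, `R := β(y')²/β(y)²`):
* §1 `sqrt_pow_mul_IPWB_le : √(y/y')^{k+1} · Λ_{2k}(y') ≤ Λ_{2k}(y)` (`0 < y ≤ y'`; entropy lemma at two fugacities);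
* §2 `rpow_pwbMean_le_tsum_mul_pow_of_summable : r^{m(y)} ≤ Σ_k f_k(y) r^k` (every `r > 0`, given summability);
* §3 `sqrt_mul_pwbLaw_mul_pow_le`, `summable_pwbLaw_mul_pow_pinch`, `sqrt_mul_tsum_pwbLaw_mul_pow_le_one : √(y/y')·Σ_k f_k(y') r^k ≤ 1`;
* §4 ★ `rpow_pwbMean_pinch_le : (√(y/y')·R)^{m(y')} ≤ √(y'/y)`; ★★ `pwbMean_mul_log_sq_wallRate_div_le : m(y')·log R ≤ ½(1 + m(y'))·L`;
  ★★ `log_sq_wallRate_div_le_half_mul_log : log R ≤ (½ + 1/(2m(y')))·L`; `sq_wallRate_div_le_rpow : R ≤ (y'/y)^{½ + 1/(2m(y'))}`;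
  ★★★ `log_sq_wallRate_div_pinch : L/m(y) ≤ log R ≤ (½ + 1/(2m(y')))·L` and `sq_wallRate_div_pinch` (power form) — with car 53;
* §5 ★ `one_add_inv_le_pwbMean : 1 + 1/(5y² + 1) ≤ m(y)` and `mul_pwbMean_ge : 5y² + 2 ≤ (5y² + 1)·m(y)` (`y > μ⁴`);
  ★★ `log_sq_wallRate_div_le_explicit : log R ≤ (1 − 1/(10y'² + 4))·L`, `sq_wallRate_div_le_rpow_explicit : R ≤ (y'/y)^{1 − 1/(10y'² + 4)}`;
* §6 ★ `inv_pwbMean_le_half_add : 1/m(y) ≤ ½ + 1/(2m(y'))`; `pwbMean_sub_one_le_of_lt_two : m(y) < 2 → m(y') − 1 ≤ 2(m(y) − 1)/(2 − m(y))`.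

HONEST LABEL.  LANE COROLLARY (D on car 53) of the tree's renewal structure; size S.  NEW-IN-WRITING (modest): the upper chord
`ρ ≤ ½(1 + 1/m)`, the explicit defect density `1 − ρ(y) ≥ 1/(10y² + 4)` on the whole adsorbed renewal regime `y > μ⁴`, and the
quasi-monotonicity of `m`.  The MECHANISM is classical and cited as such: Kesten's relation `Σ λ_k μ^{−k} = 1` [MadrasSlade1993, §4.2,
(4.2.4) (p. 91); Kesten1963SAW, §4], the renewal structure of bridges [MadrasSlade1993, §4.2, Theorem 4.2.2 (pp. 91–92)], the free energy's
log-derivative as the density of visits / energy density [HammersleyTorrieWhittington1982, §2; JansevanRensburg2000, §3.3, (3.17) and §5.4;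
Hollander2009, §7.1, Theorem 7.3 and (7.26)], the entropy bound for irreducible bridges [MadrasSlade1993, §4.2, remark before (4.2.21)
(p. 94)], Jensen / convexity of generating functions [Feller1968, XIII.3].  NOT claimed: existence of `ρ(y)` (differentiability of `β`),
anything at or below `y = μ⁴`, the sharp constant `2/y²`, monotonicity of `m`.  PRESEARCH (corpus fts + vec AND galaxy, 2026-08-25):
nearest printed statement = the EXACT visit density `(z − 2)/(2z − 2)` (`z > 2`) of adsorbing STAIRCASE walks, the solvable directed analogue
[corpus: book:janse-van-rensburg2015-statistical-mechanics-interacting-walks-polygons-animals, PDF p. 109, §4.5.2, eq. (4.131): "The density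
of visits is the first derivative of the free energy to log z"]; corpus hybrid «adsorbed self-avoiding walk density of surface contacts upper
bound renewal irreducible bridges» → Madras–Slade 1993 / Slade 2006 / Guttmann (ed.) LNP 775 (renewal structure of bridges, no density bound);
galaxy «adsorbing self-avoiding|adsorbed self-avoiding|irreducible bridges» (all stars) → the same held monographs [galaxy: panama:220512210911251,
panama:462997474508802, panama:378137510674450]; no two-sided bound on the visit density of adsorbed (undirected) walks or bridges in terms of
the mean renewal length was found in either corpus.
-/

open Finset Filter Function
open Literature.Probability.LatticeModels
open _root_.Topology

namespace Literature.Probability.RandomPlanarGeometry.SAW.HexBW.Wall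

variable {y y' : ℝ} {n : ℕ} {ω : ℕ → Site 2}

/-! ## 1. The entropy lemma at two fugacities: `√(y/y')^{k+1} Λ_{2k}(y') ≤ Λ_{2k}(y)` -/

/-- **Entropy comparison at two fugacities**: for `0 < y ≤ y'` and every `k`, `√(y/y')^{k+1} · Λ_{2k}(y') ≤ Λ_{2k}(y)` — an irreducible
positive wall bridge of length `2k` has at most `(k+1)/2` visits (`four_mul_visits_le`), so `y^v ≥ y'^v · √(y/y')^{k+1}`.
[cite: MadrasSlade1993, §4.2, remark before (4.2.21) (p. 94: an irreducible bridge of span L has at least 3L steps)]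
[cite: HammersleyTorrieWhittington1982, §2] -/
theorem sqrt_pow_mul_IPWB_le (hy : 0 < y) (h : y ≤ y') (k : ℕ) :
    Real.sqrt (y / y') ^ (k + 1) * IPWB (2 * k) y' ≤ IPWB (2 * k) y := by
  have hy' : 0 < y' := hy.trans_le h
  have hq0 : 0 ≤ y / y' := by positivity
  have hq1 : y / y' ≤ 1 := (div_le_one hy').2 h
  have hs0 : 0 ≤ Real.sqrt (y / y') := Real.sqrt_nonneg _
  have hs1 : Real.sqrt (y / y') ≤ 1 := Real.sqrt_le_one.2 hq1
  unfold IPWB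
  rw [Finset.mul_sum]
  refine Finset.sum_le_sum fun ω hω => ?_
  have h4 := four_mul_visits_le hω
  have h2v : 2 * visits (2 * k) ω ≤ k + 1 := by omega
  calc Real.sqrt (y / y') ^ (k + 1) * y' ^ visits (2 * k) ω
      ≤ Real.sqrt (y / y') ^ (2 * visits (2 * k) ω) * y' ^ visits (2 * k) ω :=
        mul_le_mul_of_nonneg_right (pow_le_pow_of_le_one hs0 hs1 h2v) (pow_nonneg hy'.le _)
    _ = (y / y') ^ visits (2 * k) ω * y' ^ visits (2 * k) ω := by rw [pow_mul, Real.sq_sqrt hq0]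
    _ = y ^ visits (2 * k) ω := by rw [← mul_pow, div_mul_cancel₀ y hy'.ne']

/-! ## 2. Jensen for the renewal law at every radius: `r^{m(y)} ≤ Σ_k f_k(y) r^k` given summability -/

/-- Convexity of the exponential at `t₀`: `e^{t₀}·(1 + (t − t₀)) ≤ e^t`. [cite: Feller1968, XIII.3 (convexity of generating functions)] -/
private theorem exp_mul_one_add_sub_le_exp_ep (t t₀ : ℝ) : Real.exp t₀ * (1 + (t - t₀)) ≤ Real.exp t := by
  have h := Real.add_one_le_exp (t - t₀)
  calc Real.exp t₀ * (1 + (t - t₀)) ≤ Real.exp t₀ * Real.exp (t - t₀) :=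
        mul_le_mul_of_nonneg_left (by linarith) (Real.exp_pos _).le
    _ = Real.exp t := by rw [← Real.exp_add]; ring_nf

/-- **Jensen's inequality for the first-renewal law at every radius**: for `y > μ⁴` and EVERY `r > 0` such that `Σ_k f_k(y) r^k`
converges, `r^{m(y)} ≤ Σ_k f_k(y) r^k` (tangent inequality `r^m (1 + (k − m) log r) ≤ r^k` summed against `Σ f_k = 1`, `Σ k f_k = m`;
the case `r ≤ 1`, where summability is automatic, is car 53's `rpow_pwbMean_le_tsum_mul_pow`).
[cite: Feller1968, XIII.3, Theorem 1 (a persistent renewal law has total mass 1)] [cite: MadrasSlade1993, §4.2, (4.2.4) (p. 91)] -/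
theorem rpow_pwbMean_le_tsum_mul_pow_of_summable (hy : hexConnectiveConstant ^ 4 < y) {r : ℝ} (hr : 0 < r)
    (hS : Summable fun k : ℕ => pwbLaw y k * r ^ k) : r ^ pwbMean y ≤ ∑' k : ℕ, pwbLaw y k * r ^ k := by
  have hμ := hexConnectiveConstant_pos
  have hy0 : 0 < y := lt_of_le_of_lt (by positivity) hy
  have hf1 := hasSum_pwbLaw hy
  have hfm : HasSum (fun k : ℕ => (k : ℝ) * pwbLaw y k) (pwbMean y) := (summable_mul_pwbLaw hy).hasSum
  set L := Real.log r with hL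
  set m := pwbMean y with hm
  have hg : HasSum (fun k : ℕ => r ^ m * (pwbLaw y k + L * ((k : ℝ) * pwbLaw y k - m * pwbLaw y k))) (r ^ m) := by
    have h := ((hf1.add ((hfm.sub (hf1.mul_left m)).mul_left L)).mul_left (r ^ m))
    simp only [mul_one, sub_self, mul_zero, add_zero] at h
    exact h
  refine hasSum_le (fun k => ?_) hg hS.hasSum
  have hrk : (r : ℝ) ^ k = Real.exp ((k : ℝ) * L) := by
    rw [← Real.rpow_natCast, Real.rpow_def_of_pos hr, mul_comm]
  have hrm : r ^ m = Real.exp (m * L) := by rw [Real.rpow_def_of_pos hr, mul_comm]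
  have htan := exp_mul_one_add_sub_le_exp_ep ((k : ℝ) * L) (m * L)
  have hf0 := pwbLaw_nonneg hy0.le k
  calc r ^ m * (pwbLaw y k + L * ((k : ℝ) * pwbLaw y k - m * pwbLaw y k))
      = pwbLaw y k * (Real.exp (m * L) * (1 + ((k : ℝ) * L - m * L))) := by rw [hrm]; ring
    _ ≤ pwbLaw y k * Real.exp ((k : ℝ) * L) := mul_le_mul_of_nonneg_left htan hf0
    _ = pwbLaw y k * r ^ k := by rw [hrk]

/-! ## 3. Kesten's relation at the lower fugacity dominates the tilted law at the upper one -/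

/-- Pointwise domination: `√(y/y') · f_k(y') · r^k ≤ f_k(y)` with `r = √(y/y')·β(y')²/β(y)²` (`0 < y ≤ y'`), i.e.
`√(y/y')^{k+1} Λ_{2k}(y') β(y)^{−2k} ≤ Λ_{2k}(y) β(y)^{−2k}`. [cite: MadrasSlade1993, §4.2, (4.2.4)–(4.2.5) (p. 91)] [cite: HammersleyTorrieWhittington1982, §2] -/
theorem sqrt_mul_pwbLaw_mul_pow_le (hy : 0 < y) (h : y ≤ y') (k : ℕ) :
    Real.sqrt (y / y') * (pwbLaw y' k * (Real.sqrt (y / y') * (wallRate y' ^ 2 / wallRate y ^ 2)) ^ k) ≤ pwbLaw y k := by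
  have hy' : 0 < y' := hy.trans_le h
  have hβ : wallRate y ≠ 0 := (wallRate_pos y).ne'
  have hβ' : wallRate y' ≠ 0 := (wallRate_pos y').ne'
  have hid : Real.sqrt (y / y') * (pwbLaw y' k * (Real.sqrt (y / y') * (wallRate y' ^ 2 / wallRate y ^ 2)) ^ k)
      = Real.sqrt (y / y') ^ (k + 1) * IPWB (2 * k) y' / wallRate y ^ (2 * k) := by
    rw [pwbLaw, mul_pow, div_pow, ← pow_mul, ← pow_mul]
    field_simp
    ring
  rw [hid, pwbLaw]
  exact div_le_div_of_nonneg_right (sqrt_pow_mul_IPWB_le hy h k) (pow_pos (wallRate_pos y) _).le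

/-- The tilted upper law is summable: `Σ_k f_k(y')·(√(y/y') β(y')²/β(y)²)^k < ∞` for `μ⁴ < y ≤ y'` (dominated by `Σ_k f_k(y) = 1`).
[cite: MadrasSlade1993, §4.2, (4.2.4) (p. 91)] [cite: Feller1968, XIII.3] -/
theorem summable_pwbLaw_mul_pow_pinch (hy : hexConnectiveConstant ^ 4 < y) (h : y ≤ y') :
    Summable fun k : ℕ => pwbLaw y' k * (Real.sqrt (y / y') * (wallRate y' ^ 2 / wallRate y ^ 2)) ^ k := by
  have hμ := hexConnectiveConstant_pos
  have hy0 : 0 < y := lt_of_le_of_lt (by positivity) hy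
  have hy'0 : 0 < y' := hy0.trans_le h
  have hβ := wallRate_pos y
  have hβ' := wallRate_pos y'
  have hs : 0 < Real.sqrt (y / y') := Real.sqrt_pos.2 (by positivity)
  have hr0 : 0 < Real.sqrt (y / y') * (wallRate y' ^ 2 / wallRate y ^ 2) := by positivity
  refine Summable.of_nonneg_of_le (fun k => mul_nonneg (pwbLaw_nonneg hy'0.le k) (pow_nonneg hr0.le k)) (fun k => ?_)
    ((hasSum_pwbLaw hy).summable.mul_left (Real.sqrt (y / y'))⁻¹)
  have hk := sqrt_mul_pwbLaw_mul_pow_le hy0 h k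
  calc pwbLaw y' k * (Real.sqrt (y / y') * (wallRate y' ^ 2 / wallRate y ^ 2)) ^ k
      = (Real.sqrt (y / y'))⁻¹ * (Real.sqrt (y / y') *
          (pwbLaw y' k * (Real.sqrt (y / y') * (wallRate y' ^ 2 / wallRate y ^ 2)) ^ k)) := by
        rw [← mul_assoc, inv_mul_cancel₀ hs.ne', one_mul]
    _ ≤ (Real.sqrt (y / y'))⁻¹ * pwbLaw y k := mul_le_mul_of_nonneg_left hk (inv_nonneg.2 hs.le)

/-- ★ **Kesten at the lower fugacity dominates the tilted law at the upper one**: `√(y/y') · Σ_k f_k(y') (√(y/y') β(y')²/β(y)²)^k ≤ Σ_k f_k(y) = 1`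
for `μ⁴ < y ≤ y'`. [cite: MadrasSlade1993, §4.2, (4.2.4) (p. 91: Σ_k λ_k μ^{-k} = 1)] [cite: Kesten1963SAW, §4] -/
theorem sqrt_mul_tsum_pwbLaw_mul_pow_le_one (hy : hexConnectiveConstant ^ 4 < y) (h : y ≤ y') :
    Real.sqrt (y / y') * ∑' k : ℕ, pwbLaw y' k * (Real.sqrt (y / y') * (wallRate y' ^ 2 / wallRate y ^ 2)) ^ k ≤ 1 := by
  have hμ := hexConnectiveConstant_pos
  have hy0 : 0 < y := lt_of_le_of_lt (by positivity) hy
  rw [← tsum_mul_left]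
  have hS := (summable_pwbLaw_mul_pow_pinch hy h).mul_left (Real.sqrt (y / y'))
  have h1 := hasSum_pwbLaw hy
  rw [← h1.tsum_eq]
  exact Summable.tsum_le_tsum (fun k => sqrt_mul_pwbLaw_mul_pow_le hy0 h k) hS h1.summable

/-! ## 4. The upper chord: `log(β(y')²/β(y)²) ≤ ½(1 + 1/m(y'))·log(y'/y)`, and the pinch -/

/-- ★ **`(√(y/y') · β(y')²/β(y)²)^{m(y')} ≤ √(y'/y)`** for `μ⁴ < y ≤ y'` (real power): Jensen under the law at the UPPER fugacity against
Kesten's relation at the LOWER one. [cite: MadrasSlade1993, §4.2, (4.2.4) (p. 91)] [cite: Feller1968, XIII.3]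
[cite: Hollander2009, §7.1, Theorem 7.3 and (7.26) (free-energy derivative = density of pinned monomers)] -/
theorem rpow_pwbMean_pinch_le (hy : hexConnectiveConstant ^ 4 < y) (h : y ≤ y') :
    (Real.sqrt (y / y') * (wallRate y' ^ 2 / wallRate y ^ 2)) ^ pwbMean y' ≤ Real.sqrt (y' / y) := by
  have hμ := hexConnectiveConstant_pos
  have hy0 : 0 < y := lt_of_le_of_lt (by positivity) hy
  have hy'0 : 0 < y' := hy0.trans_le h
  have hy' : hexConnectiveConstant ^ 4 < y' := lt_of_lt_of_le hy h
  have hβ := wallRate_pos y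
  have hβ' := wallRate_pos y'
  have hs : 0 < Real.sqrt (y / y') := Real.sqrt_pos.2 (by positivity)
  have hr0 : 0 < Real.sqrt (y / y') * (wallRate y' ^ 2 / wallRate y ^ 2) := by positivity
  have hJ := rpow_pwbMean_le_tsum_mul_pow_of_summable hy' hr0 (summable_pwbLaw_mul_pow_pinch hy h)
  have hK := sqrt_mul_tsum_pwbLaw_mul_pow_le_one hy h
  have hT : ∑' k : ℕ, pwbLaw y' k * (Real.sqrt (y / y') * (wallRate y' ^ 2 / wallRate y ^ 2)) ^ k
      ≤ 1 / Real.sqrt (y / y') := (le_div_iff₀' hs).2 hK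
  have he : 1 / Real.sqrt (y / y') = Real.sqrt (y' / y) := by
    rw [one_div, ← Real.sqrt_inv, inv_div]
  exact hJ.trans (hT.trans_eq he)

/-- ★★ **`m(y') · log(β(y')²/β(y)²) ≤ ½ (1 + m(y')) · log(y'/y)`** for `μ⁴ < y ≤ y'`: the visit density is at most the average of the renewal
density `1/m` and the maximal per-piece density `½`. [cite: HammersleyTorrieWhittington1982, §2]
[cite: JansevanRensburg2000, §3.3, (3.17) (the log-derivative of the free energy is the energy density)] [cite: MadrasSlade1993, §4.2, (4.2.4) (p. 91)] -/
theorem pwbMean_mul_log_sq_wallRate_div_le (hy : hexConnectiveConstant ^ 4 < y) (h : y ≤ y') :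
    pwbMean y' * Real.log (wallRate y' ^ 2 / wallRate y ^ 2) ≤ (1 + pwbMean y') / 2 * Real.log (y' / y) := by
  have hμ := hexConnectiveConstant_pos
  have hy0 : 0 < y := lt_of_le_of_lt (by positivity) hy
  have hy'0 : 0 < y' := hy0.trans_le h
  have hβ := wallRate_pos y
  have hβ' := wallRate_pos y'
  have hq : 0 < y / y' := by positivity
  have hq' : 0 < y' / y := by positivity
  have hs : 0 < Real.sqrt (y / y') := Real.sqrt_pos.2 hq
  have hR : 0 < wallRate y' ^ 2 / wallRate y ^ 2 := by positivity
  have hr0 : 0 < Real.sqrt (y / y') * (wallRate y' ^ 2 / wallRate y ^ 2) := by positivity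
  have h1 := rpow_pwbMean_pinch_le hy h
  have h2 := Real.log_le_log (Real.rpow_pos_of_pos hr0 _) h1
  rw [Real.log_rpow hr0, Real.log_mul hs.ne' hR.ne', Real.log_sqrt hq.le, Real.log_sqrt hq'.le] at h2
  have h3 : Real.log (y / y') = -Real.log (y' / y) := by rw [← Real.log_inv, inv_div]
  rw [h3] at h2
  linarith

/-- ★★ **THE UPPER CHORD**: `log(β(y')²/β(y)²) ≤ (½ + 1/(2 m(y'))) · log(y'/y)` for `μ⁴ < y ≤ y'` — strictly inside the tree's `≤ log(y'/y)`
(`wallRate_le_sqrt_mul`) as soon as `m(y') > 1`. [cite: BeatonBousquetMelouDeGierDuminilCopinGuttmann2014, §3.1, Proposition 5 (arXiv v5 p. 9: non-decreasing,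
log-convex; p. 10: μ(y) ∼ √y)] [cite: HammersleyTorrieWhittington1982, §2] [cite: MadrasSlade1993, §4.2, (4.2.4) (p. 91)] -/
theorem log_sq_wallRate_div_le_half_mul_log (hy : hexConnectiveConstant ^ 4 < y) (h : y ≤ y') :
    Real.log (wallRate y' ^ 2 / wallRate y ^ 2) ≤ (1 / 2 + 1 / (2 * pwbMean y')) * Real.log (y' / y) := by
  have hy' : hexConnectiveConstant ^ 4 < y' := lt_of_lt_of_le hy h
  have hm' := pwbMean_pos hy'
  have h1 := pwbMean_mul_log_sq_wallRate_div_le hy h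
  have key : (1 / 2 + 1 / (2 * pwbMean y')) * Real.log (y' / y) = ((1 + pwbMean y') / 2 * Real.log (y' / y)) / pwbMean y' := by
    field_simp
    ring
  rw [key, le_div_iff₀ hm', mul_comm]
  exact h1

/-- Power form of the upper chord: `β(y')²/β(y)² ≤ (y'/y)^{½ + 1/(2m(y'))}` for `μ⁴ < y ≤ y'`.
[cite: HammersleyTorrieWhittington1982, §2] [cite: MadrasSlade1993, §4.2, (4.2.4) (p. 91)] -/
theorem sq_wallRate_div_le_rpow (hy : hexConnectiveConstant ^ 4 < y) (h : y ≤ y') :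
    wallRate y' ^ 2 / wallRate y ^ 2 ≤ (y' / y) ^ (1 / 2 + 1 / (2 * pwbMean y')) := by
  have hμ := hexConnectiveConstant_pos
  have hy0 : 0 < y := lt_of_le_of_lt (by positivity) hy
  have hy'0 : 0 < y' := hy0.trans_le h
  have hβ := wallRate_pos y
  have hβ' := wallRate_pos y'
  have hq' : 0 < y' / y := by positivity
  have hR : 0 < wallRate y' ^ 2 / wallRate y ^ 2 := by positivity
  have h1 := log_sq_wallRate_div_le_half_mul_log hy h
  calc wallRate y' ^ 2 / wallRate y ^ 2 = Real.exp (Real.log (wallRate y' ^ 2 / wallRate y ^ 2)) := (Real.exp_log hR).symm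
    _ ≤ Real.exp ((1 / 2 + 1 / (2 * pwbMean y')) * Real.log (y' / y)) := Real.exp_le_exp.2 h1
    _ = (y' / y) ^ (1 / 2 + 1 / (2 * pwbMean y')) := by rw [Real.rpow_def_of_pos hq', mul_comm]

/-- ★★★ **THE PINCH** (with car 53's lower chord): `log(y'/y)/m(y) ≤ log(β(y')²/β(y)²) ≤ (½ + 1/(2m(y')))·log(y'/y)` for `μ⁴ < y ≤ y'` — the
local exponent of `β²` (the visit density, where it exists) lies between the renewal density `1/m(y)` and `½(1 + 1/m(y'))`.
[cite: HammersleyTorrieWhittington1982, §2] [cite: JansevanRensburg2000, §5.4, Theorem 5.55 and the preceding paragraph (adsorbed: positive density of visits)]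
[cite: MadrasSlade1993, §4.2, (4.2.4) (p. 91)] -/
theorem log_sq_wallRate_div_pinch (hy : hexConnectiveConstant ^ 4 < y) (h : y ≤ y') :
    Real.log (y' / y) / pwbMean y ≤ Real.log (wallRate y' ^ 2 / wallRate y ^ 2) ∧
      Real.log (wallRate y' ^ 2 / wallRate y ^ 2) ≤ (1 / 2 + 1 / (2 * pwbMean y')) * Real.log (y' / y) :=
  ⟨(log_sq_wallRate_div_two_sided hy h).1, log_sq_wallRate_div_le_half_mul_log hy h⟩

/-- The pinch in power form: `(y'/y)^{1/m(y)} ≤ β(y')²/β(y)² ≤ (y'/y)^{½ + 1/(2m(y'))}` for `μ⁴ < y ≤ y'`.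
[cite: HammersleyTorrieWhittington1982, §2] [cite: MadrasSlade1993, §4.2, (4.2.4) (p. 91)] -/
theorem sq_wallRate_div_pinch (hy : hexConnectiveConstant ^ 4 < y) (h : y ≤ y') :
    (y' / y) ^ (pwbMean y)⁻¹ ≤ wallRate y' ^ 2 / wallRate y ^ 2 ∧
      wallRate y' ^ 2 / wallRate y ^ 2 ≤ (y' / y) ^ (1 / 2 + 1 / (2 * pwbMean y')) :=
  ⟨div_rpow_inv_pwbMean_le hy h, sq_wallRate_div_le_rpow hy h⟩

/-! ## 5. The explicit floor `m(y) ≥ 1 + 1/(5y² + 1)` and the explicit defect density `1 − ρ ≥ 1/(10y² + 4)` -/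

/-- `μ⁴ = (2 + √2)² ≥ 2`, so `y > μ⁴` forces `y ≥ 2`. [cite: DuminilCopinSmirnov2012, Theorem 1 (μ = √(2+√2))] -/
private theorem two_le_of_mu_four_lt_ep (hy : hexConnectiveConstant ^ 4 < y) : 2 ≤ y := by
  have h2 : hexConnectiveConstant ^ 2 = 2 + Real.sqrt 2 := by
    rw [hexConnectiveConstant_eq_of_thm1 DuminilCopinSmirnov2012_thm1_holds, Real.sq_sqrt (by positivity)]
  have h4 : hexConnectiveConstant ^ 4 = (2 + Real.sqrt 2) ^ 2 := by rw [← h2]; ring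
  have hs : 0 ≤ Real.sqrt 2 := Real.sqrt_nonneg 2
  nlinarith [h4, hs]

/-- The only positive wall bridge of length `2` is the straight walk `(0,0) → (1,0) → (2,0)` (a bridge gains abscissa at its first step and
cannot lose it at the second; an arch ends on the wall). [cite: BeatonBousquetMelouDeGierDuminilCopinGuttmann2014, §3.1 (arXiv v5 p. 8: walks and arches in the half-plane)] -/
private theorem pwb_two_subset_ep : pwb 2 ⊆ {Zd.straightWalk 2 2} := by
  intro ω hω
  rw [Finset.mem_singleton]
  obtain ⟨hwbr, hbr⟩ := mem_pwb.1 hω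
  obtain ⟨harch, -⟩ := mem_wbr.1 hwbr
  obtain ⟨hhpw, -, h21⟩ := mem_archs.1 harch
  obtain ⟨hsaw, -⟩ := mem_hpw.1 hhpw
  obtain ⟨h0, hend, hbw, -⟩ := mem_saws_iff.1 hsaw
  have h00 : ω 0 0 = 0 := by simp [h0]
  have h01 : ω 0 1 = 0 := by simp [h0]
  have hs0 : brickWallGraph.Adj (ω 0) (ω 1) := hbw 0 (by norm_num)
  have hs1 : brickWallGraph.Adj (ω 1) (ω 2) := hbw 1 (by norm_num)
  rw [brickWallGraph_adj_coord] at hs0 hs1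
  have hb1 : ω 0 0 < ω 1 0 ∧ ω 1 0 ≤ ω 2 0 := hbr 1 le_rfl (by norm_num)
  have h10 : ω 1 0 = 1 := by omega
  have h11 : ω 1 1 = 0 := by omega
  have h20 : ω 2 0 = 2 := by omega
  funext i
  have hX : ω i 0 = ((min i 2 : ℕ) : ℤ) := by
    rcases Nat.lt_or_ge i 2 with hi | hi
    · interval_cases i
      · simp [h00]
      · simp [h10]
    · rw [hend i hi, min_eq_right hi, h20]; norm_num
  have hY : ω i 1 = 0 := by
    rcases Nat.lt_or_ge i 2 with hi | hi
    · interval_cases i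
      · exact h01
      · exact h11
    · rw [hend i hi, h21]
  funext j
  fin_cases j
  · simpa [straightWalk_apply_zero] using hX
  · simpa [straightWalk_apply_one] using hY

/-- `f₁(y) ≤ y/β(y)²` (`Λ₂(y) ≤ P₂(y) ≤ y`: the single atom). [cite: MadrasSlade1993, §4.2, Theorem 4.2.2(b) (pp. 91–92)]
[cite: BeatonBousquetMelouDeGierDuminilCopinGuttmann2014, §3.1 (arXiv v5 p. 8)] -/
private theorem pwbLaw_one_le_div_ep (hy : 0 ≤ y) : pwbLaw y 1 ≤ y / wallRate y ^ 2 := by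
  have hv : visits 2 (Zd.straightWalk 2 2) = 1 := (straightWalk_mem_pwb 1).2
  have hP : PWB 2 y ≤ y := by
    unfold PWB
    calc ∑ ω ∈ pwb 2, y ^ visits 2 ω ≤ ∑ ω ∈ ({Zd.straightWalk 2 2} : Finset (ℕ → Site 2)), y ^ visits 2 ω :=
          Finset.sum_le_sum_of_subset_of_nonneg pwb_two_subset_ep (fun _ _ _ => pow_nonneg hy _)
      _ = y := by rw [Finset.sum_singleton, hv, pow_one]
  show IPWB 2 y / wallRate y ^ 2 ≤ y / wallRate y ^ 2
  exact div_le_div_of_nonneg_right ((IPWB_le_PWB 2 hy).trans hP) (pow_pos (wallRate_pos y) 2).le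

/-- `2 − f₁(y) ≤ m(y)` for `y > μ⁴` (`m = Σ k f_k ≥ f₁ + 2 Σ_{k ≥ 2} f_k = 2 − f₁`). [cite: Feller1968, XIII.3] [cite: MadrasSlade1993, §4.2, Theorem 4.2.2(b) (pp. 91–92)] -/
theorem two_sub_pwbLaw_one_le_pwbMean (hy : hexConnectiveConstant ^ 4 < y) : 2 - pwbLaw y 1 ≤ pwbMean y := by
  have hμ := hexConnectiveConstant_pos
  have hy0 : 0 < y := lt_of_le_of_lt (by positivity) hy
  have hf1 := hasSum_pwbLaw hy
  have hfm : HasSum (fun k : ℕ => (k : ℝ) * pwbLaw y k) (pwbMean y) := (summable_mul_pwbLaw hy).hasSum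
  have hg : HasSum (fun k : ℕ => 2 * pwbLaw y k - (if k = 1 then pwbLaw y 1 else 0)) (2 * 1 - pwbLaw y 1) :=
    (hf1.mul_left 2).sub (hasSum_ite_eq 1 (pwbLaw y 1))
  rw [mul_one] at hg
  refine hasSum_le (fun k => ?_) hg hfm
  have hf0 := pwbLaw_nonneg hy0.le k
  rcases Nat.lt_or_ge k 2 with hk | hk
  · interval_cases k
    · simp [pwbLaw_zero]
    · rw [if_pos rfl]
      push_cast
      linarith
  · rw [if_neg (by omega)]
    have hk2 : (2 : ℝ) ≤ k := by exact_mod_cast hk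
    nlinarith

/-- ★ **Explicit floor on the mean renewal length**: `1 + 1/(5y² + 1) ≤ m(y)` for every `y > μ⁴` (`m ≥ 2 − f₁ ≥ 2 − y/β²` and the tree's
window `β² ≥ y + 1/(5y)`). [cite: MadrasSlade1993, §4.2, Theorem 4.2.2(b) (pp. 91–92)]
[cite: BeatonBousquetMelouDeGierDuminilCopinGuttmann2014, §3.1, Proposition 5 (arXiv v5 p. 10: μ(y) ∼ √y)] -/
theorem one_add_inv_le_pwbMean (hy : hexConnectiveConstant ^ 4 < y) : 1 + 1 / (5 * y ^ 2 + 1) ≤ pwbMean y := by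
  have hy2 := two_le_of_mu_four_lt_ep hy
  have hy0 : 0 < y := by linarith
  have hw := add_inv_le_wallRate_sq hy2
  have h1 := two_sub_pwbLaw_one_le_pwbMean hy
  have h2 := pwbLaw_one_le_div_ep hy0.le
  have h3 : y / wallRate y ^ 2 ≤ y / (y + 1 / (5 * y)) := div_le_div_of_nonneg_left hy0.le (by positivity) hw
  have h4 : y / (y + 1 / (5 * y)) = 5 * y ^ 2 / (5 * y ^ 2 + 1) := by
    field_simp
  have h5 : 1 + 1 / (5 * y ^ 2 + 1) = 2 - 5 * y ^ 2 / (5 * y ^ 2 + 1) := by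
    field_simp
    ring
  rw [h5]
  linarith [h3.trans_eq h4]

/-- The floor in product form: `5y² + 2 ≤ (5y² + 1)·m(y)` for `y > μ⁴`. [cite: MadrasSlade1993, §4.2, Theorem 4.2.2(b) (pp. 91–92)] -/
theorem mul_pwbMean_ge (hy : hexConnectiveConstant ^ 4 < y) : 5 * y ^ 2 + 2 ≤ (5 * y ^ 2 + 1) * pwbMean y := by
  have h := one_add_inv_le_pwbMean hy
  have hD : (0 : ℝ) < 5 * y ^ 2 + 1 := by positivity
  have e : (1 + 1 / (5 * y ^ 2 + 1)) * (5 * y ^ 2 + 1) = 5 * y ^ 2 + 2 := by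
    field_simp
    ring
  calc 5 * y ^ 2 + 2 = (1 + 1 / (5 * y ^ 2 + 1)) * (5 * y ^ 2 + 1) := e.symm
    _ ≤ pwbMean y * (5 * y ^ 2 + 1) := mul_le_mul_of_nonneg_right h hD.le
    _ = (5 * y ^ 2 + 1) * pwbMean y := mul_comm _ _

/-- ★★ **EXPLICIT DEFECT DENSITY of the adsorbed phase**: `log(β(y')²/β(y)²) ≤ (1 − 1/(10 y'² + 4)) · log(y'/y)` for all `μ⁴ < y ≤ y'` — a long
adsorbed bridge spends at least a fraction `1/(10y² + 4)` of its even times off the wall.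
[cite: BeatonBousquetMelouDeGierDuminilCopinGuttmann2014, §3.1, Proposition 5 (arXiv v5 p. 9–10)] [cite: HammersleyTorrieWhittington1982, §2]
[cite: JansevanRensburg2000, §5.4, Theorem 5.55 (adsorbed phase: positive density of visits)] -/
theorem log_sq_wallRate_div_le_explicit (hy : hexConnectiveConstant ^ 4 < y) (h : y ≤ y') :
    Real.log (wallRate y' ^ 2 / wallRate y ^ 2) ≤ (1 - 1 / (10 * y' ^ 2 + 4)) * Real.log (y' / y) := by
  have hμ := hexConnectiveConstant_pos
  have hy0 : 0 < y := lt_of_le_of_lt (by positivity) hy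
  have hy'0 : 0 < y' := hy0.trans_le h
  have hy' : hexConnectiveConstant ^ 4 < y' := lt_of_lt_of_le hy h
  have hm' := pwbMean_pos hy'
  have hm2 := mul_pwbMean_ge hy'
  have hL : 0 ≤ Real.log (y' / y) := Real.log_nonneg ((one_le_div hy0).2 h)
  have h1 := log_sq_wallRate_div_le_half_mul_log hy h
  have hc : 1 / (2 * pwbMean y') ≤ (5 * y' ^ 2 + 1) / (10 * y' ^ 2 + 4) := by
    rw [div_le_div_iff₀ (by positivity) (by positivity)]
    nlinarith [hm2]
  have hc' : 1 / 2 + 1 / (2 * pwbMean y') ≤ 1 - 1 / (10 * y' ^ 2 + 4) := by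
    have e : (1 : ℝ) - 1 / (10 * y' ^ 2 + 4) = 1 / 2 + (5 * y' ^ 2 + 1) / (10 * y' ^ 2 + 4) := by
      field_simp
      ring
    rw [e]
    linarith
  exact h1.trans (mul_le_mul_of_nonneg_right hc' hL)

/-- Power form: `β(y')²/β(y)² ≤ (y'/y)^{1 − 1/(10y'² + 4)}` for `μ⁴ < y ≤ y'`. [cite: BeatonBousquetMelouDeGierDuminilCopinGuttmann2014, §3.1, Proposition 5 (arXiv v5 p. 9–10)]
[cite: HammersleyTorrieWhittington1982, §2] -/
theorem sq_wallRate_div_le_rpow_explicit (hy : hexConnectiveConstant ^ 4 < y) (h : y ≤ y') :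
    wallRate y' ^ 2 / wallRate y ^ 2 ≤ (y' / y) ^ (1 - 1 / (10 * y' ^ 2 + 4)) := by
  have hμ := hexConnectiveConstant_pos
  have hy0 : 0 < y := lt_of_le_of_lt (by positivity) hy
  have hy'0 : 0 < y' := hy0.trans_le h
  have hβ := wallRate_pos y
  have hβ' := wallRate_pos y'
  have hq' : 0 < y' / y := by positivity
  have hR : 0 < wallRate y' ^ 2 / wallRate y ^ 2 := by positivity
  have h1 := log_sq_wallRate_div_le_explicit hy h
  calc wallRate y' ^ 2 / wallRate y ^ 2 = Real.exp (Real.log (wallRate y' ^ 2 / wallRate y ^ 2)) := (Real.exp_log hR).symm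
    _ ≤ Real.exp ((1 - 1 / (10 * y' ^ 2 + 4)) * Real.log (y' / y)) := Real.exp_le_exp.2 h1
    _ = (y' / y) ^ (1 - 1 / (10 * y' ^ 2 + 4)) := by rw [Real.rpow_def_of_pos hq', mul_comm]

/-! ## 6. Quasi-monotonicity of the mean renewal length -/

/-- ★ **`1/m(y) ≤ ½ (1 + 1/m(y'))` for `μ⁴ < y ≤ y'`**: the renewal density at the lower fugacity is at most the pinch's upper end at the
higher one (both chords of `log_sq_wallRate_div_pinch` divided by `log(y'/y) > 0`; trivial at `y = y'`). The mean renewal length is not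
known to be monotone; unlike a modulus of continuity this comparison does not degrade with the gap `y' − y`. [cite: MadrasSlade1993, §4.2, Theorem 4.2.2(b) (pp. 91–92)] [cite: Feller1968, XIII.3] -/
theorem inv_pwbMean_le_half_add (hy : hexConnectiveConstant ^ 4 < y) (h : y ≤ y') :
    (pwbMean y)⁻¹ ≤ 1 / 2 + 1 / (2 * pwbMean y') := by
  have hμ := hexConnectiveConstant_pos
  have hy0 : 0 < y := lt_of_le_of_lt (by positivity) hy
  rcases eq_or_lt_of_le h with rfl | hlt
  · have hm := one_le_pwbMean hy
    have hm0 := pwbMean_pos hy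
    have hi : (pwbMean y)⁻¹ ≤ 1 := inv_le_one_of_one_le₀ hm
    have e : 1 / 2 + 1 / (2 * pwbMean y) = (1 + (pwbMean y)⁻¹) / 2 := by
      field_simp
    rw [e]
    linarith
  · have hL : 0 < Real.log (y' / y) := Real.log_pos ((one_lt_div hy0).2 hlt)
    obtain ⟨h1, h2⟩ := log_sq_wallRate_div_pinch hy h
    have h3 : (pwbMean y)⁻¹ * Real.log (y' / y) ≤ (1 / 2 + 1 / (2 * pwbMean y')) * Real.log (y' / y) := by
      rw [← div_eq_inv_mul]
      exact h1.trans h2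
    exact le_of_mul_le_mul_right h3 hL

/-- ★ **Quasi-monotonicity**: if `m(y) < 2` then `m(y') − 1 ≤ 2 (m(y) − 1)/(2 − m(y))` for every `y' ≥ y` (`y > μ⁴`) — going up in fugacity
the excess mean block length can at most double, to first order. [cite: MadrasSlade1993, §4.2, Theorem 4.2.2(b) (pp. 91–92)] [cite: Feller1968, XIII.3] -/
theorem pwbMean_sub_one_le_of_lt_two (hy : hexConnectiveConstant ^ 4 < y) (h : y ≤ y') (hm2 : pwbMean y < 2) :
    pwbMean y' - 1 ≤ 2 * (pwbMean y - 1) / (2 - pwbMean y) := by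
  have hy' : hexConnectiveConstant ^ 4 < y' := lt_of_lt_of_le hy h
  have hm0 := pwbMean_pos hy
  have hm'0 := pwbMean_pos hy'
  have hq := inv_pwbMean_le_half_add hy h
  have h1 : 1 ≤ pwbMean y * (1 / 2 + 1 / (2 * pwbMean y')) := by
    have := mul_le_mul_of_nonneg_left hq hm0.le
    rwa [mul_inv_cancel₀ hm0.ne'] at this
  have h2 : pwbMean y * (1 / 2 + 1 / (2 * pwbMean y')) * (2 * pwbMean y') = pwbMean y * pwbMean y' + pwbMean y := by
    field_simp
  have h3 : 1 * (2 * pwbMean y') ≤ pwbMean y * (1 / 2 + 1 / (2 * pwbMean y')) * (2 * pwbMean y') :=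
    mul_le_mul_of_nonneg_right h1 (by positivity)
  rw [h2, one_mul] at h3
  rw [le_div_iff₀ (by linarith)]
  nlinarith [h3]

end Literature.Probability.RandomPlanarGeometry.SAW.HexBW.Wall
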